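import Mathlib
import HarnessLib
import Summits.MatrixMultiplication.MatrixMultiplication.Theses.AsymptoticRankCW
import Summits.MatrixMultiplication.MatrixMultiplication.Theorems.AsymptoticRankCWBPerm3Form
import Literature.Computability.AlgebraicComplexity.AsymptoticRankConjecture
import Literature.Computability.AlgebraicComplexity.AsymptoticSpectrumDuality
import Literature.Barriers.MatrixMultiplication.RectangularBarrierUpperSupportProofs
import Literature.Barriers.MatrixMultiplication.IrreversibilityBarrierThm22

/-!
# Crux `BThesis` (stmt-MatrixMultiplication-0588) — `Lines/birth.lean`, the BC3 birth skeleton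

Route `AsymptoticRankCW` (route-MatrixMultiplication-AsymptoticRankCW; deciding theorem
`closes (hX : BThesis) : MatrixMultiplication` PROVED from the tree's Coppersmith–Winograd 1990
asymptotic-rank bound, so `BThesis` = X_B = "`R̃(T_cw,2) ≤ 3`" in growth form is the route's one open
load-bearing leaf — re-audit bin HONEST-BET-1LEAF).

THE LINE = the structural mechanism the route header itself names under NOT DECOMPOSED YET ("a proof of
X_B needs a structural mechanism (tight-tensor asymptotic rank conjecture at m = 3)"), written in the
language in which the tree now has tools — Strassen's ASYMPTOTIC SPECTRUM, with duality
`R̃(t) = max_{F ∈ Δ(ℂ)} F(t)` PROVED in tree (`strassen_duality_asymptoticRank_holds`), the upper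
support functionals `ζ^θ` (`upperSupportFunctional`) and their flattening bound PROVED in tree
(`logUpperSupportFunctional_le_flatteningRank`):

* `stub_cwTwo_conciseTight : IsConcise (T_cw,2) ∧ IsTight (T_cw,2)` — `T_cw,2` is concise (all three
  flattening ranks are `3`, `flatteningRank_cwTensor`) and TIGHT in the sense of CGLVW Def. 1.1 /
  BCS (15.34): in the CGLV basis `A = !![1,0,0; 0,1,-i; 0,1,i]` (tree: `cglv_exists_basis_cwTensor_two`,
  `(A,A,A)·T_cw,2 = 2∑_σ e_{σ(0)} ⊗ e_{σ(1)} ⊗ e_{σ(2)}`) the support is the six permutations of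
  `(0,1,2)`, tight for `τ_A = τ_B = τ_C = (j ↦ j − 1)`. Size S/M, PROVABLE NOW. (The standard CW
  support `{(0,j,j),(j,0,j),(j,j,0)}` is NOT tight — the three equations force `τ_A(1) = τ_A(2)` — so the
  change of basis is essential: this is exactly the identification "X_B = the `m = 3` instance of
  Strassen's asymptotic rank conjecture" of the route's NOVELTY section, made a lemma.)
* `stub_tightSpectralDomination` — the load-bearing bet, OPEN: on CONCISE TIGHT tensors of format
  `3 × 3 × 3` every universal spectral point is dominated by an upper support functional,
  `∀ F ∈ Δ(ℂ), ∃ θ ∈ P([3]), F(t) ≤ ζ^θ(t)`. This is the format-`(3,3,3)` slice of Strassen's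
  conjecture that the support functionals exhaust the asymptotic spectrum of tight tensors
  (Strassen 1994 §5.3 = ConnerGesmundoLandsbergVenturaWang2021 Conj. 3.2, "`R̃(T) = max_θ ζ^θ(T)` for
  tight `T`", whose consequence Conj. 1.4 is `StrassenAsymptoticRankConjecture` in tree); it is implied
  by a positive answer to Christandl–Vrana–Zuiddam's question whether the quantum functionals are ALL
  of `Δ(ℂ)` (then `F = F^θ ≤ ζ^θ`, CVZ Thm. 3.34), and for the FREE tensor `T_cw,2` the quantum and
  support functionals coincide (CVZ Thm. 4.20) and all equal `3`.
* `upperSupportFunctional_le_three` (sorry-free): `ζ^θ(t) ≤ 3` for every `t ∈ ℂ³ ⊗ ℂ³ ⊗ ℂ³`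
  (Strassen's flattening bound `ρ^θ ≤ ∑ θ_i log₂ ζ⁽ⁱ⁾ ≤ log₂ 3`).
* `asymptoticRank_cwTensor_two_le_three_of` (sorry-free core): stub₁-sig → stub₂-sig → `R̃(T_cw,2) ≤ 3`,
  by duality (an `F ∈ Δ(ℂ)` with `F(T_cw,2) = R̃(T_cw,2)`), domination and the bound.
* `isBigO_of_asymptoticRank_cwTensor_two_le_three` (sorry-free): `R̃(T_cw,2) ≤ 3 ⇒` the growth form
  (the one-step unfolding of `BThesis` over `kroneckerPow (cwTensor ℂ 2) N`, which is the route's inline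
  Kronecker power by `rfl`), by Fekete (`isBigO_of_asymptoticRank_le`, tree).
* `BThesis_of : BThesis` — THE skeleton theorem: the crux BY NAME from the two declared stubs BY NAME
  (`sorry` occurs ONLY inside the two `stub_*`; `closed = false` only through them), exactly the shape
  the skeleton checker registers (`skeleton.extra-hypothesis` otherwise).

Honest status. Given stub 1, duality and the flattening identity `ζ^{(1,0,0)}(t) = 3` on concise
`3 × 3 × 3` tensors, stub 2 is EQUIVALENT to Strassen's asymptotic rank conjecture in format `(3,3,3)`
(CGLVW Conj. 1.4 at `m = 3`), hence STRONGER than the crux (it also gives `R̃(T_skewcw,2) = 3`, the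
route's crux #3 `BDet3AsymptoticRank`, since `T_skewcw,2 ≅ ε_{ijk}` has the same tight support): the
skeleton isolates the mechanism (no universal spectral point separates a tight `3 × 3 × 3` tensor from
its support functionals) and the exact seam; it does not make X_B easier than that conjecture. Why the
transfer has teeth: the statement is now about the compact convex set `Δ(ℂ)` restricted to ONE
GL₃³-stable codimension-2 subvariety (CGLVW Thm. 1.9) — a classification problem for spectral points,
attackable by the moment-polytope / quantum-functional machinery vendored in tree
(`QuantumFunctionals*.lean`), where X_B alone offers no structure beyond one tensor.
Disproof used: no `Disproof.lean` / `Negative/` lemma exists for this crux (`ledger crux ls`: no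
workfiles, 2026-08-17); the refuter's crux attack (evidence `BThesisCruxAttack.lean`) records only
`bThesis_false_without_pos` (`0 < ε` load-bearing) — honoured: `BThesis_of` proves the `0 < ε` form.
`ledger negatives --problem MatrixMultiplication` has no statement on tight `3 × 3 × 3` tensors or on
`Δ(ℂ)` at `T_cw,2`. Kill: one universal spectral point `F` with `F(t) > 3` at one concise tight
`t ∈ ℂ³⊗ℂ³⊗ℂ³` refutes stub 2 (at `t = T_cw,2` it refutes the crux and closes the route); `ω > 2`
refutes both via `closes`.
-/

-- `Summit.<Summit>.<Problem>`: for the single-conjunct summit the duplicate component is mandated.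
set_option linter.dupNamespace false

noncomputable section

open Filter Asymptotics Topology

namespace Summit.MatrixMultiplication.MatrixMultiplication.Cruxes.BThesis.Birth

open Literature.Computability.AlgebraicComplexity
open Literature.Barriers.MatrixMultiplication (IsConcise flatteningRank_le_card
  logUpperSupportFunctional_le_flatteningRank)
open Summit.MatrixMultiplication.MatrixMultiplication.Theorems (isBigO_of_asymptoticRank_le)

/-! ## The two registered stubs -/

/-- **Stub 1 — `T_cw,2` is concise and tight.** Concise: the three flattenings of
`T_cw,2 = ∑_{j=1,2} a₀⊗b_j⊗c_j + a_j⊗b₀⊗c_j + a_j⊗b_j⊗c₀` have rank `3` (`flatteningRank_cwTensor`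
and the cyclic symmetry of `T_cw,2`). Tight (CGLVW Def. 1.1 = BCS Def. (15.34), the tree's `IsTight`:
tight support in SOME bases): with the CGLV matrix `A = !![1,0,0; 0,1,-i; 0,1,i]`
(`cglv_exists_basis_cwTensor_two`: `(A,A,A)·T_cw,2 = 2|ε_{ijk}|`, `det A = 2i ≠ 0`, so
`A ∈ GL₃(ℂ)` via `Matrix.GeneralLinearGroup.mkOfDetNeZero`) the support is
`{(σ(0),σ(1),σ(2)) : σ ∈ 𝔖₃}`, tight for the injective labels `τ_A = τ_B = τ_C = (j ↦ j − 1)`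
(`(σ(0)−1)+(σ(1)−1)+(σ(2)−1) = 0`). Why plausibly true: it is a theorem (the standard-basis support is
not tight, the CGLV basis is). Size S/M. Role: puts `T_cw,2` inside the class on which stub 2 speaks.
Sources: ConnerGesmundoLandsbergVenturaWang2021 (arXiv:1811.05511) Def. 1.1 and p. 5 ("the `m = 3`
case"); ConnerGesmundoLandsbergVentura2022 §3.2; BurgisserClausenShokrollahi1997 Def. (15.34). -/
theorem stub_cwTwo_conciseTight :
    IsConcise (cwTensor ℂ 2) ∧ IsTight (cwTensor ℂ 2) := by
  sorry

/-- **Stub 2 — spectral domination on tight `3 × 3 × 3` tensors (the load-bearing bet, OPEN).**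
For every concise tight `t ∈ ℂ³ ⊗ ℂ³ ⊗ ℂ³` and every universal spectral point `F ∈ Δ(ℂ)`
(`IsUniversalSpectralPoint`: monotone under restriction, multiplicative under `⊠`, additive under `⊕`,
`F⟨1⟩ = 1`) there is `θ ∈ P([3])` with `F(t) ≤ ζ^θ(t)` (`upperSupportFunctional`, CVZ Def. 2.3).
The format-`(3,3,3)` slice of Strassen's conjecture that the upper support functionals compute the
asymptotic spectrum — hence the asymptotic rank — of tight tensors (Strassen 1994 §5.3;
CGLVW 2021 Conj. 3.2, with Conj. 1.4 = `StrassenAsymptoticRankConjecture` as consequence). Why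
plausibly true: every universal spectral point KNOWN over `ℂ` is a quantum functional `F^θ ≤ ζ^θ`
(CVZ Thm. 3.34), with equality on free tensors such as `T_cw,2` (CVZ Thm. 4.20); a positive answer to
CVZ's question "is `Δ(ℂ)` the set of quantum functionals?" implies the stub outright. Why it might
fail: a new ("dark") universal spectral point exceeding `3` at one concise tight `3 × 3 × 3` tensor —
none is known; at `t = T_cw,2` it would refute X_B itself. Size XL / open.
Sources: Strassen1991, ChristandlVranaZuiddam2023 (Def. 2.3, Thm. 3.34, Thm. 4.20, §1.2),
ConnerGesmundoLandsbergVenturaWang2021 (arXiv:1811.05511, Conj. 1.4 / §3), WigdersonZuiddam notes. -/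
theorem stub_tightSpectralDomination :
    ∀ t : Fin 3 → Fin 3 → Fin 3 → ℂ, IsConcise t → IsTight t →
      ∀ F : SpectralMap ℂ, IsUniversalSpectralPoint ℂ F →
        ∃ θ ∈ stdSimplex ℝ (Fin 3), F t ≤ upperSupportFunctional θ t := by
  sorry

/-! ## Sorry-free core -/

/-- **`ζ^θ(t) ≤ 3` on `ℂ³ ⊗ ℂ³ ⊗ ℂ³`** for every `θ ∈ P([3])`: Strassen's flattening bound
`ρ^θ(t) ≤ ∑ᵢ θᵢ log₂ ζ⁽ⁱ⁾(t)` (tree: `logUpperSupportFunctional_le_flatteningRank`) with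
`ζ⁽ⁱ⁾(t) ≤ 3` (`flatteningRank_le_card`) and `∑ θᵢ = 1`; `ζ^θ(0) = 0`. [folklore] -/
theorem upperSupportFunctional_le_three {θ : Fin 3 → ℝ} (hθ : θ ∈ stdSimplex ℝ (Fin 3))
    (t : Fin 3 → Fin 3 → Fin 3 → ℂ) : upperSupportFunctional θ t ≤ 3 := by
  by_cases ht : t = 0
  · subst ht
    rw [upperSupportFunctional_zero]
    norm_num
  have hL : 0 < Real.log 2 := Real.log_pos one_lt_two
  -- each flattening rank is at most `3`, hence its `log` is at most `log 3`
  have hlog : ∀ {ι' κ' μ' : Type} [Fintype ι'] [Fintype κ'] [Fintype μ']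
      (s : ι' → κ' → μ' → ℂ), Fintype.card ι' = 3 → Real.log (flatteningRank s) ≤ Real.log 3 := by
    intro ι' κ' μ' _ _ _ s hcard
    have hle : (flatteningRank s : ℝ) ≤ 3 := by
      have := flatteningRank_le_card s
      rw [hcard] at this
      exact_mod_cast this
    rcases Nat.eq_zero_or_pos (flatteningRank s) with h0 | hpos
    · rw [h0, Nat.cast_zero, Real.log_zero]
      exact Real.log_nonneg (by norm_num)
    · exact Real.log_le_log (by exact_mod_cast hpos) hle
  have e₁ : Real.log (flatteningRank t) / Real.log 2 ≤ Real.log 3 / Real.log 2 :=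
    div_le_div_of_nonneg_right (hlog t (Fintype.card_fin 3)) hL.le
  have e₂ : Real.log (flatteningRank (rotate t)) / Real.log 2 ≤ Real.log 3 / Real.log 2 :=
    div_le_div_of_nonneg_right (hlog (rotate t) (Fintype.card_fin 3)) hL.le
  have e₃ : Real.log (flatteningRank (rotate (rotate t))) / Real.log 2 ≤ Real.log 3 / Real.log 2 :=
    div_le_div_of_nonneg_right (hlog (rotate (rotate t)) (Fintype.card_fin 3)) hL.le
  have hsum : θ 0 + θ 1 + θ 2 = 1 := by
    have h := hθ.2
    simpa [Fin.sum_univ_three] using h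
  have key : logUpperSupportFunctional θ t ≤ Real.logb 2 3 := by
    refine (logUpperSupportFunctional_le_flatteningRank hθ.1 t).trans ?_
    calc θ 0 * (Real.log (flatteningRank t) / Real.log 2) +
          θ 1 * (Real.log (flatteningRank (rotate t)) / Real.log 2) +
          θ 2 * (Real.log (flatteningRank (rotate (rotate t))) / Real.log 2)
        ≤ θ 0 * (Real.log 3 / Real.log 2) + θ 1 * (Real.log 3 / Real.log 2) +
          θ 2 * (Real.log 3 / Real.log 2) :=
          add_le_add (add_le_add (mul_le_mul_of_nonneg_left e₁ (hθ.1 0))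
            (mul_le_mul_of_nonneg_left e₂ (hθ.1 1))) (mul_le_mul_of_nonneg_left e₃ (hθ.1 2))
      _ = Real.logb 2 3 := by
          rw [Real.logb, ← add_mul, ← add_mul, hsum, one_mul]
  have hne : upperSupportFunctional θ t = (2 : ℝ) ^ logUpperSupportFunctional θ t := if_neg ht
  rw [hne]
  calc (2 : ℝ) ^ logUpperSupportFunctional θ t ≤ (2 : ℝ) ^ Real.logb 2 3 :=
        Real.rpow_le_rpow_of_exponent_le one_le_two key
    _ = 3 := Real.rpow_logb two_pos (by norm_num) (by norm_num)

/-- **Composition with explicit hypotheses** (the BC3 shape `stub₁-sig → stub₂-sig → …`, conclusion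
`R̃(T_cw,2) ≤ 3`): by Strassen duality (PROVED in tree, `strassen_duality_asymptoticRank_holds`) some
`F ∈ Δ(ℂ)` attains `F(T_cw,2) = R̃(T_cw,2)`; stub 1 puts `T_cw,2` in the concise tight class, stub 2
dominates `F(T_cw,2) ≤ ζ^θ(T_cw,2)` for some `θ ∈ P([3])`, and `ζ^θ ≤ 3` in format `(3,3,3)`.
Sorry-free, standard axioms. [folklore] -/
theorem asymptoticRank_cwTensor_two_le_three_of
    (h₁ : IsConcise (cwTensor ℂ 2) ∧ IsTight (cwTensor ℂ 2))
    (h₂ : ∀ t : Fin 3 → Fin 3 → Fin 3 → ℂ, IsConcise t → IsTight t →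
      ∀ F : SpectralMap ℂ, IsUniversalSpectralPoint ℂ F →
        ∃ θ ∈ stdSimplex ℝ (Fin 3), F t ≤ upperSupportFunctional θ t) :
    asymptoticRank (cwTensor ℂ 2) ≤ 3 := by
  obtain ⟨F, hF, hFt⟩ := (strassen_duality_asymptoticRank_holds ℂ (cwTensor ℂ 2)).2
  rw [← hFt]
  obtain ⟨θ, hθ, hFθ⟩ := h₂ (cwTensor ℂ 2) h₁.1 h₁.2 F hF
  exact hFθ.trans (upperSupportFunctional_le_three hθ (cwTensor ℂ 2))

/-! ## The skeleton theorem: the two stubs prove the crux BY NAME -/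

/-- **Growth form** (conclusion = the one-step unfolding of `BThesis` over `kroneckerPow (cwTensor ℂ 2)`,
which is the route's inline Kronecker power by `rfl`): `R̃(T_cw,2) ≤ 3 ⇒ ∀ ε > 0,
R(T_cw,2^{⊠N}) = O(3^{(1+ε)N})`, by Fekete's limit form `R(t^{⊠N})^{1/N} → R̃(t)`
(`isBigO_of_asymptoticRank_le`, tree). Sorry-free. [folklore] -/
theorem isBigO_of_asymptoticRank_cwTensor_two_le_three (h : asymptoticRank (cwTensor ℂ 2) ≤ 3) :
    ∀ ε : ℝ, 0 < ε →
      (fun N : ℕ => (tensorRank (kroneckerPow (cwTensor ℂ 2) N) : ℝ)) =O[atTop]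
        fun N : ℕ => (3 : ℝ) ^ ((1 + ε) * N) :=
  fun _ hε => isBigO_of_asymptoticRank_le (cwTensor ℂ 2) (by norm_num) h hε

/-- **THE SKELETON THEOREM.** The crux
`Summit.MatrixMultiplication.MatrixMultiplication.Theses.AsymptoticRankCW.BThesis`
(stmt-MatrixMultiplication-0588, X_B: `∀ ε > 0, R(T_cw,2^{⊠N}) = O(3^{(1+ε)N})`), concluded BY NAME from
the two DECLARED stubs `stub_cwTwo_conciseTight` and `stub_tightSpectralDomination` (the only `sorry`s of
the file) through the sorry-free composition `asymptoticRank_cwTensor_two_le_three_of` (Strassen duality +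
`ζ^θ ≤ 3`) and the growth-form bridge `isBigO_of_asymptoticRank_cwTensor_two_le_three` (Fekete); the
route's inline Kronecker power is `kroneckerPow (cwTensor ℂ 2) N` definitionally. [folklore] -/
theorem BThesis_of : Summit.MatrixMultiplication.MatrixMultiplication.Theses.AsymptoticRankCW.BThesis :=
  isBigO_of_asymptoticRank_cwTensor_two_le_three
    (asymptoticRank_cwTensor_two_le_three_of stub_cwTwo_conciseTight stub_tightSpectralDomination)

end Summit.MatrixMultiplication.MatrixMultiplication.Cruxes.BThesis.Birth

end
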